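import Summits.BirchSwinnertonDyer.BirchSwinnertonDyer.Theorems.RamifiedSevenEllipticUnitsQuadraticRamificationOfPinning
import Literature.NumberTheory.GaloisRepresentations.HeckeCharacterConductorExponentProofs
import Literature.NumberTheory.GaloisRepresentations.LocalUnitsPrimeToPProofs
import Literature.NumberTheory.GaloisRepresentations.GlobalArtinMapBlockNormProofs
import Literature.RingTheory.DiscreteValuationRing.AdicCompletionResidueField
import Literature.NumberTheory.GaloisRepresentations.DegreeOnePlacesProofs
import HarnessLib

set_option linter.dupNamespace false
set_option autoImplicit false

/-!
# K7r crux `EllipticUnitValueSevenOfGZK` (stmt-BirchSwinnertonDyer-19945), line `rubin-formula-zp` v4.4 —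
# (P3) AT THE FRAME PRIME WITHOUT UNIT VALUES (cell `bsd-cm`, seat `bsd-cm-k7r-c2` g13, FILE 2; helper)

HONEST FRAMING. Clause (P3) of the Rubin package asks that the interpolated character `φ^{2·7^m+1}` be
RAMIFIED at `𝔭 ∣ 7`. Skeleton v4.4 derives it from H_QR's `𝔭`-square clause «`φ²` unramified at `𝔭`», which
consumes the PRINT fact Deuring-with-UNIT-VALUES (Silverman ATAEC II 9.1 (i) ≈ Gross (8.2.7): conductor
exponent `1`). THIS FILE proves the clause actually consumed — «`φ^M` unramified at `𝔭` ⇒ `φ` unramified at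
`𝔭`» for `M` prime to `14` — with NO print fact, for every `c`-EQUIVARIANT Hecke character at a place
`𝔭 ∋ 7` fixed by `c` with `N𝔭 = 7`: `ε = φ_𝔭|𝒪_𝔭ˣ` has order dividing `2·7^f`. (i) `ε` is trivial on a higher
unit group (`exists_isTrivialOnHigherUnitsAt`) and `7`-th powers contract principal units
(`OneUnits.valued_pow_pow_sub_one_le`) ⇒ `ε(u)^{7^f} = 1` for `u ≡ 1 (mod 𝔭)` (§1); (ii) the residue field
`𝓞_K/𝔭 ≅ 𝔽₇` of `𝒪_𝔭` (`residueFieldEquiv`) is generated by `3` ⇒ every unit is `3^k·`(principal) (§2);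
(iii) the idele `⟨3⟩_𝔭` is `c`-FIXED (`galAdicCompletionMap_algebraMap`), so equivariance makes `ε(3)` REAL,
and `ε(3)^{6·7^f} = 1` (`3⁶ − 1 = 7·104`) ⇒ `ε(3) = ±1` (§3); hence `ε^{2·7^f} = 1`, and `gcd(M, 2·7^f) = 1`
forces `ε = 1` (§4 **`OddPowerLocal.isUnramifiedAt_of_pow_of_coprime`**). The sequel
`…RubinPackageOfTwist` specialises to the O11 frame of a 𝒞₇ member (where the pinned character IS ramified
at `𝔭`, k7r-c3 g13 p518373) and re-assembles the Rubin package without the unit-values fact. Purely local +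
equivariance; no print fact, no definition; nothing about BSD.

References: [TateThesis1967] §2.3; [Serre1979] II §1, IV §1–2; [NeukirchANT1999] II (5.3)–(5.7), VII (6.10);
[CasselsFrohlichANT1967] VII §1.1; [Gross1980] §8 (8.2.7) (made idle; shape only); STATUS 2026-08-27 D196.
-/

noncomputable section

open scoped Classical ComplexConjugate
open Filter NumberField IsDedekindDomain WeierstrassCurve IsLocalRing WithZero
  Literature.NumberTheory.GaloisRepresentations
  Literature.NumberTheory.Automorphic
  Literature.NumberTheory.EllipticCurves
  Literature.NumberTheory.EllipticCurves.Rank1Residual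
  Summit.BirchSwinnertonDyer.Rank1Residual Summit.BirchSwinnertonDyer.Rank1Residual.X12
  Summit.BirchSwinnertonDyer.Rank1Residual.X12.O11

namespace Summit.BirchSwinnertonDyer.BirchSwinnertonDyer.Theorems.RamifiedSevenEllipticUnits

namespace OddPowerLocal

variable {K : Type} [Field K] [NumberField K] (𝔭 : HeightOneSpectrum (𝓞 K))

/-! ## §0. Valuation bookkeeping in `ℤᵐ⁰` -/

/-- In `ℤᵐ⁰`, `x < 1 ↔ x ≤ exp (−1)`. [folklore] -/
theorem lt_one_iff_le_exp_neg_one (x : WithZero (Multiplicative ℤ)) : x < 1 ↔ x ≤ exp (-1) := by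
  rcases eq_or_ne x 0 with rfl | hx
  · exact ⟨fun _ ↦ zero_le, fun _ ↦ zero_lt_one⟩
  · rw [← exp_log hx, ← exp_zero, exp_lt_exp, exp_le_exp]
    omega

/-- The value of a natural number lying in `𝔭` is `≤ exp (−1)`. [folklore] -/
theorem valued_natCast_le_of_mem {n : ℕ} (hn : ((n : ℕ) : 𝓞 K) ∈ 𝔭.asIdeal) :
    Valued.v ((n : ℕ) : 𝔭.adicCompletion K) ≤ exp (-1) := by
  have h : ((n : ℕ) : 𝔭.adicCompletion K) = algebraMap K (𝔭.adicCompletion K) ((n : 𝓞 K) : K) := by simp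
  rw [h]
  change Valued.v ((((n : 𝓞 K) : K)) : 𝔭.adicCompletion K) ≤ _
  rw [HeightOneSpectrum.valuedAdicCompletion_eq_valuation', HeightOneSpectrum.valuation_of_algebraMap]
  have h1 : 𝔭.intValuation (n : 𝓞 K) ≤ exp (-((1 : ℕ) : ℤ)) :=
    (𝔭.intValuation_le_pow_iff_mem _ 1).2 (by rwa [pow_one])
  simpa using h1

/-- A natural number NOT in `𝔭` is a unit of `𝒪_𝔭`: its value is `1`. [folklore] -/
theorem valued_natCast_eq_one_of_notMem {n : ℕ} (hn : ((n : ℕ) : 𝓞 K) ∉ 𝔭.asIdeal) :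
    Valued.v ((n : ℕ) : 𝔭.adicCompletion K) = 1 := by
  have h : ((n : ℕ) : 𝔭.adicCompletion K) = algebraMap K (𝔭.adicCompletion K) ((n : 𝓞 K) : K) := by simp
  rw [h]
  change Valued.v ((((n : 𝓞 K) : K)) : 𝔭.adicCompletion K) = _
  rw [HeightOneSpectrum.valuedAdicCompletion_eq_valuation', HeightOneSpectrum.valuation_of_algebraMap]
  exact (𝔭.intValuation_eq_one_iff).mpr hn

/-! ## §1. Principal units: `ε(u)^{p^f} = 1` -/

/-- **A local component kills principal units after a `p`-power**: if `p ∈ 𝔭` then there is `f` with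
`χ_𝔭(u)^{p^f} = 1` for every unit `u ≡ 1 (mod 𝔭)` of `𝒪_𝔭` (`χ_𝔭` is trivial on `U^{(f)}` and
`u^{p^f} ∈ U^{(f)}` since `|u^{p^j} − 1| ≤ max(|p|, |u − 1|)^j |u − 1|`).
[cite: TateThesis1967, §2.3] [cite: NeukirchANT1999, Ch. II (5.3)–(5.7)] -/
theorem localComponent_pow_eq_one_of_principal (χ : HeckeCharacter K) {p : ℕ}
    (hp : ((p : ℕ) : 𝓞 K) ∈ 𝔭.asIdeal) :
    ∃ f : ℕ, ∀ u : (𝔭.adicCompletionIntegers K)ˣ,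
      Valued.v (((u : 𝔭.adicCompletionIntegers K) : 𝔭.adicCompletion K) - 1) < 1 →
        χ.localComponent 𝔭 (Units.map ((𝔭.adicCompletionIntegers K).subtype : _ →* _) u) ^ p ^ f = 1 := by
  obtain ⟨f, hf⟩ := HeckeCharacter.exists_isTrivialOnHigherUnitsAt χ 𝔭
  refine ⟨f, fun u hu ↦ ?_⟩
  set y : 𝔭.adicCompletion K := ((u : 𝔭.adicCompletionIntegers K) : 𝔭.adicCompletion K) with hy
  have hu1 : Valued.v (y - 1) ≤ exp (-1) := (lt_one_iff_le_exp_neg_one _).mp hu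
  have hρ : max (Valued.v ((p : ℕ) : 𝔭.adicCompletion K)) (Valued.v (y - 1)) ≤ exp (-1) :=
    max_le (valued_natCast_le_of_mem 𝔭 hp) hu1
  -- `|y^{p^f} - 1| ≤ exp(-1)^f · exp(-1) ≤ exp(-f)`
  have hpow : Valued.v (y ^ p ^ f - 1) ≤ exp (-(f : ℤ)) := by
    have h := OneUnits.valued_pow_pow_sub_one_le K 𝔭 y (hu1.trans (by rw [← exp_zero, exp_le_exp]; norm_num)) p f
    refine h.trans ?_
    calc max (Valued.v ((p : ℕ) : 𝔭.adicCompletion K)) (Valued.v (y - 1)) ^ f * Valued.v (y - 1)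
        ≤ exp (-1) ^ f * 1 := mul_le_mul' (pow_le_pow_left' hρ f) (hu1.trans (by
            rw [← exp_zero, exp_le_exp]; norm_num))
      _ = exp (-(f : ℤ)) := by rw [mul_one, ← exp_nsmul]; simp
  -- apply triviality on `U^{(f)}` to `u^{p^f}`
  have key := hf (u ^ p ^ f) (by
    rw [Units.val_pow_eq_pow_val, Subring.coe_pow]
    exact hpow)
  rw [map_pow, map_pow] at key
  exact key

/-! ## §2. Units modulo principal units when the residue field is `𝔽₇` -/

/-- Every nonzero element of `𝔽₇` is a power of `3`. [folklore] -/
theorem zmod_seven_eq_pow_three (x : ZMod 7) (hx : x ≠ 0) : ∃ k : Fin 6, x = 3 ^ (k : ℕ) := by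
  revert x
  decide

/-- **Units of `𝒪_𝔭` are `≡ 3^k (mod 𝔭)` when `N𝔭 = 7`**: for every unit `u` of `𝒪_𝔭` there is
`k < 6` with `|u − 3^k| < 1` (the residue field of `𝒪_𝔭` is `𝓞_K/𝔭`, of prime order `7`, generated by
`3`). [cite: Serre1979, Ch. II §1 and Ch. IV §1] -/
theorem exists_valued_sub_pow_three_lt_one (hN : Ideal.absNorm 𝔭.asIdeal = 7)
    (u : (𝔭.adicCompletionIntegers K)ˣ) :
    ∃ k : ℕ, k < 6 ∧
      Valued.v (((u : 𝔭.adicCompletionIntegers K) : 𝔭.adicCompletion K) - 3 ^ k) < 1 := by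
  -- the residue field `κ` of `𝒪_𝔭` has `7` elements
  have hcardN : Nat.card (ResidueField (𝔭.adicCompletionIntegers K)) = 7 := by
    rw [HeightOneSpectrum.natCard_residueField_adicCompletionIntegers K 𝔭, ← Submodule.cardQuot_apply,
      ← Ideal.absNorm_apply, hN]
  haveI : Finite (ResidueField (𝔭.adicCompletionIntegers K)) :=
    Nat.finite_of_card_ne_zero (by rw [hcardN]; norm_num)
  letI : Fintype (ResidueField (𝔭.adicCompletionIntegers K)) := Fintype.ofFinite _
  have hcard : Fintype.card (ResidueField (𝔭.adicCompletionIntegers K)) = 7 := by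
    rw [← Nat.card_eq_fintype_card, hcardN]
  let e : ZMod 7 ≃+* ResidueField (𝔭.adicCompletionIntegers K) :=
    ZMod.ringEquivOfPrime (ResidueField (𝔭.adicCompletionIntegers K)) (by norm_num) hcard
  -- the residue of `u` is a nonzero element, hence `3^k`
  have hru : residue (𝔭.adicCompletionIntegers K) (u : 𝔭.adicCompletionIntegers K) ≠ 0 :=
    (u.isUnit.map (residue (𝔭.adicCompletionIntegers K))).ne_zero
  obtain ⟨k, hk⟩ := zmod_seven_eq_pow_three
    (e.symm (residue (𝔭.adicCompletionIntegers K) (u : 𝔭.adicCompletionIntegers K)))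
    (by rw [ne_eq, map_eq_zero_iff _ e.symm.injective]; exact hru)
  have hres : residue (𝔭.adicCompletionIntegers K)
      ((u : 𝔭.adicCompletionIntegers K) - 3 ^ (k : ℕ)) = 0 := by
    have h := congrArg e hk
    rw [RingEquiv.apply_symm_apply, map_pow] at h
    rw [map_sub, map_pow, sub_eq_zero]
    simp only [h, map_ofNat]
  refine ⟨k, k.isLt, ?_⟩
  -- `u - 3^k ∈ 𝔪`: not a unit, so its value is `< 1`
  rw [residue_eq_zero_iff, mem_maximalIdeal, mem_nonunits_iff,
    HeightOneSpectrum.adicCompletionIntegers.isUnit_iff_valued_eq_one] at hres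
  have hle : Valued.v ((((u : 𝔭.adicCompletionIntegers K) - 3 ^ (k : ℕ) :
      𝔭.adicCompletionIntegers K)) : 𝔭.adicCompletion K) ≤ 1 :=
    ((u : 𝔭.adicCompletionIntegers K) - 3 ^ (k : ℕ)).2
  have hlt := lt_of_le_of_ne hle hres
  have hcoe : ((((u : 𝔭.adicCompletionIntegers K) - 3 ^ (k : ℕ) : 𝔭.adicCompletionIntegers K)) :
      𝔭.adicCompletion K) = ((u : 𝔭.adicCompletionIntegers K) : 𝔭.adicCompletion K) - 3 ^ (k : ℕ) := by
    push_cast; rfl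
  rwa [hcoe] at hlt

/-! ## §3. Equivariance at a `c`-fixed rational unit -/

/-- `σ • ⟨u⟩_w = ⟨σ u⟩_{w'}` for any `h : σ • w = w'` (the tree's `algEquiv_smul_localUnits` is the case
`w' = σ • w`, `h = rfl`). [cite: CasselsFrohlichANT1967, Ch. VII §1.1] -/
theorem algEquiv_smul_localUnits_of_eq (σ : K ≃ₐ[ℚ] K) {w w' : HeightOneSpectrum (𝓞 K)} (h : σ • w = w')
    (u : (w.adicCompletion K)ˣ) :
    σ • localUnits w u = localUnits w' (galAdicCompletionUnitsEquiv (L := K) σ h u) := by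
  subst h
  rw [algEquiv_smul_localUnits]

/-- **A rational local unit is fixed by `Gal(K/ℚ)`**: for `σ • 𝔭 = 𝔭` and a unit `u` of `K_𝔭` whose
value is the image of `q ∈ ℚ`, `σ • ⟨u⟩_𝔭 = ⟨u⟩_𝔭`. [cite: CasselsFrohlichANT1967, Ch. VII §1.1] -/
theorem smul_localUnits_eq_of_ratCast (σ : K ≃ₐ[ℚ] K) (h : σ • 𝔭 = 𝔭) (u : (𝔭.adicCompletion K)ˣ)
    (q : ℚ) (hu : (u : 𝔭.adicCompletion K) = ((algebraMap ℚ K q : K) : 𝔭.adicCompletion K)) :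
    σ • localUnits 𝔭 u = localUnits 𝔭 u := by
  rw [algEquiv_smul_localUnits_of_eq σ h u]
  congr 1
  refine Units.ext ?_
  change galAdicCompletionMap σ h (u : 𝔭.adicCompletion K) = (u : 𝔭.adicCompletion K)
  rw [hu, galAdicCompletionMap_algebraMap]

/-- **Equivariance at a fixed unit forces a real value; a real root of unity is `±1`.** If `φ` is
`c`-equivariant, `c • 𝔭 = 𝔭`, `u` is a unit of `𝒪_𝔭` with rational value, and `φ_𝔭(u)^n = 1` for some
`n ≠ 0`, then `φ_𝔭(u)² = 1`. [cite: NeukirchANT1999, Ch. VII §6 (6.10)] -/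
theorem localComponent_sq_eq_one_of_fixed {φ : HeckeCharacter K} {c : K ≃ₐ[ℚ] K}
    (heq : IsHeckeConjEquivariant c φ) (hc : c • 𝔭 = 𝔭) (u : (𝔭.adicCompletionIntegers K)ˣ) (q : ℚ)
    (hu : ((u : 𝔭.adicCompletionIntegers K) : 𝔭.adicCompletion K) =
      ((algebraMap ℚ K q : K) : 𝔭.adicCompletion K))
    {n : ℕ} (hn : n ≠ 0)
    (hpow : φ.localComponent 𝔭 (Units.map ((𝔭.adicCompletionIntegers K).subtype : _ →* _) u) ^ n = 1) :
    φ.localComponent 𝔭 (Units.map ((𝔭.adicCompletionIntegers K).subtype : _ →* _) u) ^ 2 = 1 := by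
  set U : (𝔭.adicCompletion K)ˣ := Units.map ((𝔭.adicCompletionIntegers K).subtype : _ →* _) u with hU
  set z : ℂ := ((φ.localComponent 𝔭 U : ℂˣ) : ℂ) with hz
  -- reality from equivariance at the fixed idele `⟨u⟩_𝔭`
  have hfix : c • localUnits 𝔭 U = localUnits 𝔭 U := smul_localUnits_eq_of_ratCast 𝔭 c hc U q hu
  have hreal : conj z = z := by
    have h := heq (localUnits 𝔭 U)
    rw [HeckeCharacter.galConj_apply, hfix] at h
    rw [hz, HeckeCharacter.localComponent_apply]
    exact h.symm
  -- `z` is a root of unity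
  have hzn : z ^ n = 1 := by
    have h := congrArg (fun x : ℂˣ ↦ (x : ℂ)) hpow
    simpa [hz, hU] using h
  have hnorm : ‖z‖ = 1 := Complex.norm_eq_one_of_pow_eq_one hzn hn
  -- real of norm one: `z = ±1`
  have hzre : z = (z.re : ℂ) := by
    rw [eq_comm, ← Complex.conj_eq_iff_re]; exact hreal
  have hre : z.re = 1 ∨ z.re = -1 := by
    have h1 : |z.re| = 1 := by
      have := hnorm
      rw [hzre, Complex.norm_real, Real.norm_eq_abs] at this
      exact this
    rcases abs_eq (zero_le_one) |>.mp h1 with h | h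
    · exact Or.inl h
    · exact Or.inr h
  have hz2 : z ^ 2 = 1 := by
    rw [hzre]
    rcases hre with h | h <;> rw [h] <;> norm_num
  apply Units.ext
  rw [Units.val_pow_eq_pow_val, Units.val_one]
  exact hz2

/-! ## §4. The order of `ε = φ_𝔭|𝒪_𝔭ˣ` divides `2·7^f`; odd powers prime to `7` -/

omit [NumberField K] in
/-- `3` is a unit at a prime containing `7` (`7 − 2·3 = 1`). [folklore] -/
theorem three_notMem (h7 : ((7 : ℕ) : 𝓞 K) ∈ 𝔭.asIdeal) : ((3 : ℕ) : 𝓞 K) ∉ 𝔭.asIdeal := by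
  intro h3
  apply 𝔭.isPrime.ne_top
  rw [Ideal.eq_top_iff_one]
  have : (1 : 𝓞 K) = ((7 : ℕ) : 𝓞 K) - 2 * ((3 : ℕ) : 𝓞 K) := by push_cast; norm_num
  rw [this]
  exact Ideal.sub_mem _ h7 (Ideal.mul_mem_left _ _ h3)

/-- **`ε^{2·7^f} = 1`**: for `φ` `c`-equivariant, `c • 𝔭 = 𝔭`, `7 ∈ 𝔭` and `N𝔭 = 7`, there is `f`
with `φ_𝔭(u)^{2·7^f} = 1` for EVERY unit `u` of `𝒪_𝔭` (`u = 3^k·u₁` with `u₁` principal;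
`φ_𝔭(3)² = 1` by §3 since `3⁶ ≡ 1 (mod 𝔭)`; `φ_𝔭(u₁)^{7^f} = 1` by §1).
[cite: Serre1979, Ch. IV §1–§2 (structure of the unit group)] [cite: NeukirchANT1999, Ch. II (5.3)–(5.7)] -/
theorem localComponent_pow_two_mul_eq_one {φ : HeckeCharacter K} {c : K ≃ₐ[ℚ] K}
    (heq : IsHeckeConjEquivariant c φ) (hc : c • 𝔭 = 𝔭) (h7 : ((7 : ℕ) : 𝓞 K) ∈ 𝔭.asIdeal)
    (hN : Ideal.absNorm 𝔭.asIdeal = 7) :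
    ∃ f : ℕ, ∀ u : (𝔭.adicCompletionIntegers K)ˣ,
      φ.localComponent 𝔭 (Units.map ((𝔭.adicCompletionIntegers K).subtype : _ →* _) u) ^ (2 * 7 ^ f) = 1 := by
  set O := 𝔭.adicCompletionIntegers K with hO
  obtain ⟨f, hf⟩ := localComponent_pow_eq_one_of_principal 𝔭 φ (p := 7) h7
  refine ⟨f, fun u ↦ ?_⟩
  -- the unit `3` of `𝒪_𝔭`
  have hv3 : Valued.v ((3 : ℕ) : 𝔭.adicCompletion K) = 1 := valued_natCast_eq_one_of_notMem 𝔭 (three_notMem 𝔭 h7)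
  have h3O : Valued.v (((3 : O)) : 𝔭.adicCompletion K) = 1 := by
    have : (((3 : O)) : 𝔭.adicCompletion K) = ((3 : ℕ) : 𝔭.adicCompletion K) := by push_cast; rfl
    rw [this, hv3]
  have h3unit : IsUnit (3 : O) := HeightOneSpectrum.adicCompletionIntegers.isUnit_iff_valued_eq_one.mpr h3O
  set u₃ : Oˣ := h3unit.unit with hu₃
  have hu₃val : ((u₃ : O) : 𝔭.adicCompletion K) = 3 := by
    rw [hu₃, IsUnit.unit_spec]; rfl
  set ε : Oˣ →* ℂˣ := (φ.localComponent 𝔭).comp (Units.map (O.subtype : _ →* _)) with hε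
  change ε u ^ (2 * 7 ^ f) = 1
  -- (a) `ε(u₃)² = 1`: `u₃⁶` is principal (`3⁶ − 1 = 7·104`), so `ε(u₃)^{6·7^f} = 1`, and `ε(u₃)` is real
  have h6 : Valued.v ((((u₃ ^ 6 : Oˣ) : O) : 𝔭.adicCompletion K) - 1) < 1 := by
    rw [Units.val_pow_eq_pow_val, Subring.coe_pow, hu₃val]
    have h728 : (3 : 𝔭.adicCompletion K) ^ 6 - 1 = ((7 : ℕ) : 𝔭.adicCompletion K) * ((104 : ℕ) : 𝔭.adicCompletion K) := by
      push_cast; norm_num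
    rw [h728, map_mul]
    have h104 : Valued.v ((104 : ℕ) : 𝔭.adicCompletion K) ≤ 1 := by
      have : ((104 : ℕ) : 𝔭.adicCompletion K) = (((104 : ℕ) : O) : 𝔭.adicCompletion K) := by push_cast; rfl
      rw [this]; exact ((104 : ℕ) : O).2
    calc Valued.v ((7 : ℕ) : 𝔭.adicCompletion K) * Valued.v ((104 : ℕ) : 𝔭.adicCompletion K)
        ≤ exp (-1) * 1 := mul_le_mul' (valued_natCast_le_of_mem 𝔭 h7) h104
      _ < 1 := by rw [mul_one, ← exp_zero, exp_lt_exp]; norm_num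
  have h3pow : ε u₃ ^ (6 * 7 ^ f) = 1 := by
    have h := hf (u₃ ^ 6) h6
    rw [map_pow, map_pow] at h
    rw [pow_mul]
    exact h
  have h3sq : ε u₃ ^ 2 = 1 :=
    localComponent_sq_eq_one_of_fixed 𝔭 heq hc u₃ 3
      (by
        rw [hu₃val]
        change (3 : 𝔭.adicCompletion K) = algebraMap K (𝔭.adicCompletion K) (algebraMap ℚ K 3)
        rw [map_ofNat, map_ofNat])
      (n := 6 * 7 ^ f) (by positivity) h3pow
  -- (b) `u = u₁ · u₃^k` with `u₁` principal
  obtain ⟨k, -, hk⟩ := exists_valued_sub_pow_three_lt_one 𝔭 hN u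
  set u₁ : Oˣ := u * (u₃ ^ k)⁻¹ with hu₁
  have hu : u = u₁ * u₃ ^ k := by rw [hu₁, inv_mul_cancel_right]
  have h3K : Valued.v (3 : 𝔭.adicCompletion K) = 1 := by
    have : (3 : 𝔭.adicCompletion K) = ((3 : ℕ) : 𝔭.adicCompletion K) := by push_cast; rfl
    rw [this, hv3]
  have h3ne : (3 : 𝔭.adicCompletion K) ≠ 0 := by
    intro h0; rw [h0, map_zero] at h3K; exact zero_ne_one h3K
  have hmul : ((u₁ : O) : 𝔭.adicCompletion K) * (3 : 𝔭.adicCompletion K) ^ k =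
      ((u : O) : 𝔭.adicCompletion K) := by
    have h := congrArg (fun x : Oˣ ↦ ((x : O) : 𝔭.adicCompletion K)) hu
    simp only [Units.val_mul, Units.val_pow_eq_pow_val] at h
    push_cast at h
    rw [hu₃val] at h
    exact h.symm
  have hu₁p : Valued.v ((((u₁ : O)) : 𝔭.adicCompletion K) - 1) < 1 := by
    have hrw : ((u₁ : O) : 𝔭.adicCompletion K) - 1 =
        (((u : O) : 𝔭.adicCompletion K) - 3 ^ k) / (3 : 𝔭.adicCompletion K) ^ k := by
      rw [← hmul, ← div_sub_one (pow_ne_zero k h3ne), mul_div_cancel_right₀ _ (pow_ne_zero k h3ne)]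
    rw [hrw, map_div₀, map_pow, h3K, one_pow, div_one]
    exact hk
  have hu₁pow : ε u₁ ^ 7 ^ f = 1 := hf u₁ hu₁p
  -- (c) assemble
  rw [hu, map_mul, map_pow, mul_pow, ← pow_mul]
  have h1 : ε u₁ ^ (2 * 7 ^ f) = 1 := by rw [mul_comm, pow_mul, hu₁pow, one_pow]
  have h2 : ε u₃ ^ (k * (2 * 7 ^ f)) = 1 := by rw [mul_comm k, mul_assoc, pow_mul, h3sq, one_pow]
  rw [h1, h2, one_mul]

/-- **ODD POWERS PRIME TO `7` DETECT RAMIFICATION**: for `φ` `c`-equivariant, `c • 𝔭 = 𝔭`, `7 ∈ 𝔭`,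
`N𝔭 = 7`, and `M` coprime to `14`: if `φ^M` is unramified at `𝔭` then so is `φ` (`ε^M = 1` and
`ε^{2·7^f} = 1` with `gcd(M, 2·7^f) = 1`). No unit values, no conductor formula.
[cite: NeukirchANT1999, Ch. VII §6 (6.10)] [cite: Serre1979, Ch. IV §1–§2] -/
theorem isUnramifiedAt_of_pow_of_coprime {φ : HeckeCharacter K} {c : K ≃ₐ[ℚ] K}
    (heq : IsHeckeConjEquivariant c φ) (hc : c • 𝔭 = 𝔭) (h7 : ((7 : ℕ) : 𝓞 K) ∈ 𝔭.asIdeal)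
    (hN : Ideal.absNorm 𝔭.asIdeal = 7) {M : ℕ} (hM : M.Coprime 14) (hpow : (φ ^ M).IsUnramifiedAt 𝔭) :
    φ.IsUnramifiedAt 𝔭 := by
  obtain ⟨f, hf⟩ := localComponent_pow_two_mul_eq_one 𝔭 heq hc h7 hN
  intro u
  have h1 : φ.localComponent 𝔭 (Units.map ((𝔭.adicCompletionIntegers K).subtype : _ →* _) u) ^ M = 1 := by
    have h := hpow u
    rw [HeckeCharacter.localComponent_apply, HeckeCharacter.pow_apply] at h
    rw [HeckeCharacter.localComponent_apply]
    exact h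
  have h2 := hf u
  have hgcd : M.gcd (2 * 7 ^ f) = 1 := by
    have h14 : (14 : ℕ) = 2 * 7 := by norm_num
    rw [h14] at hM
    exact Nat.Coprime.gcd_eq_one
      (Nat.Coprime.mul_right (Nat.Coprime.coprime_mul_right_right hM)
        (Nat.Coprime.pow_right f (Nat.Coprime.coprime_mul_left_right hM)))
  have key := (pow_gcd_eq_one.mpr ⟨h1, h2⟩)
  rwa [hgcd, pow_one] at key

end OddPowerLocal

end Summit.BirchSwinnertonDyer.BirchSwinnertonDyer.Theorems.RamifiedSevenEllipticUnits

end
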